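import Summits.ResolutionOfSingularities.ResolutionOfSingularities.Theses.JacobianBudget
import Summits.ResolutionOfSingularities.ResolutionOfSingularities.Theses.FrobeniusClosing
import Summits.ResolutionOfSingularities.ResolutionOfSingularities.Theses.WildCones
import Summits.ResolutionOfSingularities.ResolutionOfSingularities.Theses.ShadowGame
import Summits.ResolutionOfSingularities.ResolutionOfSingularities.Theses.Valuative
import Summits.ResolutionOfSingularities.ResolutionOfSingularities.Theorems.ValuativeLuAlphaPTorsorKnownRanges
import Literature.AlgebraicGeometry.Resolution.ResolutionLU
import Literature.AlgebraicGeometry.Resolution.QuadraticTransforms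

/-!
# Disproof work file — crux `Steer` (stmt-ResolutionOfSingularities-16345)

Two refuter passes so far: §0–§3 = crux-attack at birth (route `JacobianBudget`, 2026-08-17T05Z);
§4–§6 = cdisprove cycle 1 (route `FrobeniusClosing`, 2026-08-17, seat
refuter-cdisprove-stmt-ResolutionOfSingularities-16345-0) — findings of cycle 1, in one breath:
NO KILL; the three bookkeeping hypotheses of the consequent are load-bearing AS THEOREMS now
(§4, perfect-field witnesses; proposed for landing as `Theorems/Steer/Negative/ConsequentLoadBearing.lean`),
and at crux level each such mutation is EQUIVALENT to `¬ IsolatedForcedTermination` (the negation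
of the route's own target); `¬ Steer ↔ IsolatedForcedTermination ∧ ¬ TorsorLUPerfect` (§5: a
refutation must contain a proof of the target AND a counterexample to LU of `α_p`-torsors over a
perfect field — the latter contradicts the summit, §1); the active line `switching-dichotomy`
(4 stubs) has NO false stub under cheap probes, but ONE MIS-CUT (§6 (d), HLOST arXiv:1505.06445
Rem. 2.4 / Prop. 4.4 / Prop. 8.7 read): the line's `StronglySwitching` (`⋃ R_i = O ∩ Frac A₀`) is
Shannon's strong switching (rank 1) PLUS Granja's height-1-directed sequences (rank 2, `ℤ ⊕ G`), and
on the latter the mechanism cited for `stub_switchingDefectless` (HLOST 4.4) does not deliver the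
monomial form — explicit inhabitant `ord_𝔪 ∘ (arc valuation)`, torsor `t^p = x`; repair = add
"rank one on `Frac A₀`" to stubs 2–3 and hand the complement to stub 4 (posted as `stub-misstated`
evidence). Also in §6: both sides of the cut are inhabited in trdeg 3 (explicit composite valuation
for the along-a-prime side), the `Defect`/`¬ Defect` split is the honest `e = 1 / e = p` dichotomy
because `f = 1`, the defectless witness automatically lies in `O` (proved), no quadratic transform
leaves a field (proved), stub 1's four ingredients are in the tree.

Crux-attack at birth (refuter, route `JacobianBudget`; the item is shared verbatim with routes
`FrobeniusClosing` and `WildCones`):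

> `Steer := IsolatedForcedTermination → (∀ p prime, ∀ perfect k of char p, K ⊇ k, O a valuation
> ring of K, A₀ ⊆ O f.g. regular at the centre, t with t ^ p ∈ A₀ and Frac (A₀[t]) = K,
> ∃ f.g. A with A₀[t] ⊆ A ⊆ O, Frac A = K, A regular at the centre)`.

## Findings (every `theorem` below is kernel-checked, no `sorry`, axioms ⊆ {propext, choice, Quot.sound})

* `steer_iff_frobeniusClosing`, `steer_iff_wildCones` — the three route copies are ONE
  proposition (definitional, `Iff.rfl`).
* `steer_iff_ift_imp_torsorLUPerfect` — `Steer ↔ (IsolatedForcedTermination → TorsorLUPerfect)`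
  with `TorsorLUPerfect` = ShadowGame's target stmt-16158 (definitional): the consequent is
  verbatim LU of `α_p`-torsors over perfect ground fields.
* `steer_of_luAlphaPTorsor` — Valuative's `LuAlphaPTorsor` (stmt-0641, all ground fields) gives
  `Steer` outright; the antecedent is not used.
* `torsorLUPerfect_of_resolutionOfSingularities`, `steer_of_resolutionOfSingularities` —
  **S → C: THE SUMMIT IMPLIES THE CRUX** (resolution in char `p` ⇒ relative LU by the tree's
  `ResolutionInChar.relLocalUniformization`, applied to the model `A₀[t]`; `t ∈ O` because
  `t ^ p ∈ A₀ ⊆ O` and valuation rings are integrally closed). Neither the regular base, nor the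
  torsor shape, nor perfectness, nor the antecedent is used. Contrapositive
  `not_resolutionOfSingularities_of_not_steer`: **a refutation of `Steer` would refute resolution
  of singularities in positive characteristic** — the crux is not refutable by any cheap means, and
  the same holds for every hypothesis-mutation of it (drop `[PerfectField k]` ⇒ `IFT → LuAlphaPTorsor`
  body; drop the antecedent ⇒ `TorsorLUPerfect`; both implied by the summit, both open in dim ≥ 4).
* Load-bearing / junk analysis of the CONSEQUENT is inherited verbatim from the standing disproof
  file of `LuAlphaPTorsor` (`Cruxes/LuAlphaPTorsor/Disproof.lean` §2–§4: `not_withoutFrac`,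
  `not_withoutFG`, `not_withoutTorsor` junk-false mutations; `case_mem`, `case_top`, `case_frac`
  true degenerate instances; `not_sameModel` = a NON-TRIVIAL inhabitant of the hypotheses,
  `A₀ = 𝔽_p[X^p]`, `t = X^(p+1)`, `O` = `X`-adic, for which `A₀[t]` itself is singular) — adding
  `[PerfectField k]` changes none of them (all witnesses live over `𝔽_p`).
* ANTECEDENT (`IsolatedForcedTermination`, the shared target stmt-16343): not junk-false — for
  `n = 1` it is true by order bookkeeping (`bl` and `tr` are the identity on `Fin 1`, each step
  divides by `u ^ p`, the least exponent `e` with `p ∤ e` drops by `p` per step, so `MultP` fails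
  after `⌈e/p⌉` steps); `n = 2` is in print (Lipman 1978 / CJS 2020, grounder note on stmt-16343);
  `n ≥ 3` is Hauser–Perlega's open forced-cycle question. So `Steer` is not vacuous today; but
  modulo a PROOF of the target (which the route itself must supply) `Steer` is logically
  EQUIVALENT to `TorsorLUPerfect` (`steer_iff_ift_imp_torsorLUPerfect`): the antecedent buys no
  logical strength, only a suggested mechanism (planner's own "why it might fail").
-/

open Summit.ResolutionOfSingularities.ResolutionOfSingularities.Theses
open Literature.AlgebraicGeometry.Resolution (RelLocalUniformization ResolutionInChar
  isFractionRing_of_le)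

set_option linter.dupNamespace false

namespace Summit.ResolutionOfSingularities.ResolutionOfSingularities.Cruxes.Steer.Disproof

/-! ## §0 Identities -/

/-- The three route copies of the crux are one proposition (definitional). -/
theorem steer_iff_frobeniusClosing : JacobianBudget.Steer ↔ FrobeniusClosing.Steer := Iff.rfl

/-- Idem for route `WildCones`. -/
theorem steer_iff_wildCones : JacobianBudget.Steer ↔ WildCones.Steer := Iff.rfl

/-- The consequent of `Steer` is verbatim ShadowGame's target `TorsorLUPerfect` (stmt-16158). -/
theorem steer_iff_ift_imp_torsorLUPerfect :
    JacobianBudget.Steer ↔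
      (JacobianBudget.IsolatedForcedTermination → ShadowGame.TorsorLUPerfect) :=
  Iff.rfl

/-- Valuative's `LuAlphaPTorsor` (all ground fields, stmt-0641) gives `Steer` outright; the
antecedent is unused. -/
theorem steer_of_luAlphaPTorsor (h : Valuative.LuAlphaPTorsor) : JacobianBudget.Steer :=
  fun _ p hp k K _ _ _ _ _ O A₀ h₀ t => h p hp k K O A₀ h₀ t

/-! ## Helpers (copied from `Cruxes/LuAlphaPTorsor/Disproof.lean`, kept local) -/

section Helpers

variable {k K : Type} [Field k] [Field K] [Algebra k K]

/-- Valuation rings are integrally closed, in the only form needed: `t ^ n ∈ O ⇒ t ∈ O`. -/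
theorem mem_of_pow_mem (O : ValuationSubring K) {t : K} {n : ℕ} (hn : n ≠ 0) (h : t ^ n ∈ O) :
    t ∈ O := by
  rw [← O.valuation_le_one_iff] at h ⊢
  rw [map_pow] at h
  by_contra hlt
  exact (one_lt_pow₀ (lt_of_not_ge hlt) hn).not_ge h

/-- `A₀[t] ⊆ O` as soon as `A₀ ⊆ O` and `t ∈ O`. -/
theorem adjoin_insert_le (O : ValuationSubring K) (A₀ : Subalgebra k K)
    (h₀ : A₀.toSubring ≤ O.toSubring) {t : K} (ht : t ∈ O) :
    (Algebra.adjoin k (insert t (A₀ : Set K))).toSubring ≤ O.toSubring := by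
  let Oalg : Subalgebra k K :=
    { O.toSubring with algebraMap_mem' := fun c => h₀ (A₀.algebraMap_mem c) }
  change Algebra.adjoin k (insert t (A₀ : Set K)) ≤ Oalg
  refine Algebra.adjoin_le ?_
  rintro x (rfl | hx)
  · exact ht
  · exact h₀ hx

/-- `A₀ ≤ A₀[t]`. -/
theorem le_adjoin_insert (A₀ : Subalgebra k K) (t : K) :
    A₀ ≤ Algebra.adjoin k (insert t (A₀ : Set K)) :=
  fun _ hx => Algebra.subset_adjoin (Set.mem_insert_of_mem _ hx)

/-- `t ∈ A₀[t]`. -/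
theorem mem_adjoin_insert (A₀ : Subalgebra k K) (t : K) :
    t ∈ Algebra.adjoin k (insert t (A₀ : Set K)) :=
  Algebra.subset_adjoin (Set.mem_insert _ _)

/-- `A₀[t]` is finitely generated when `A₀` is. -/
theorem fg_adjoin_insert {A₀ : Subalgebra k K} (hfg : A₀.FG) (t : K) :
    (Algebra.adjoin k (insert t (A₀ : Set K))).FG := by
  classical
  obtain ⟨s, rfl⟩ := hfg
  rw [Algebra.adjoin_insert_adjoin, ← Finset.coe_insert]
  exact Subalgebra.fg_adjoin_finset _

end Helpers

/-! ## §1 Position: the summit implies the crux (S → C) -/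

/-- **The summit implies ShadowGame's target** `TorsorLUPerfect` (the consequent of `Steer`):
resolution in char `p` ⇒ relative local uniformization (tree, Zariski read backwards) applied to
the model `A₀[t]`. [folklore] -/
theorem torsorLUPerfect_of_resolutionOfSingularities (hR : _root_.ResolutionOfSingularities) :
    ShadowGame.TorsorLUPerfect := by
  intro p hp k K _ _ _ _ _ O A₀ h₀ t hfg htp hfr _hreg
  have htO : t ∈ O := mem_of_pow_mem O hp.ne_zero (h₀ htp)
  have hRO := adjoin_insert_le O A₀ h₀ htO
  obtain ⟨A, h, hRA, hAfg, hreg⟩ :=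
    (hR p hp).relLocalUniformization k K O _ (fg_adjoin_insert hfg t) hfr hRO
  exact ⟨A, h, (le_adjoin_insert A₀ t).trans hRA, hRA (mem_adjoin_insert A₀ t), hAfg,
    isFractionRing_of_le hRA hfr, hreg⟩

/-- **S → C: the summit implies the crux `Steer`.** [folklore] -/
theorem steer_of_resolutionOfSingularities (hR : _root_.ResolutionOfSingularities) :
    JacobianBudget.Steer :=
  fun _ => torsorLUPerfect_of_resolutionOfSingularities hR

/-- Contrapositive: a refutation of `Steer` refutes resolution of singularities in positive
characteristic. [folklore] -/
theorem not_resolutionOfSingularities_of_not_steer (h : ¬ JacobianBudget.Steer) :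
    ¬ _root_.ResolutionOfSingularities :=
  fun H => h (steer_of_resolutionOfSingularities H)

/-! ## §2 Mutations of `Steer` — each lands on a statement implied by the summit -/

/-- `Steer` with `[PerfectField k]` dropped from the consequent: `IFT → LuAlphaPTorsor`. -/
def SteerWithoutPerfect : Prop :=
  JacobianBudget.IsolatedForcedTermination → Valuative.LuAlphaPTorsor

/-- Dropping perfectness strengthens the crux … -/
theorem steer_of_steerWithoutPerfect (h : SteerWithoutPerfect) : JacobianBudget.Steer :=
  fun hI => steer_of_luAlphaPTorsor (h hI) hI

/-- … but the strengthening is still implied by the summit (so no counterexample can show that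
`[PerfectField k]` is load-bearing). -/
theorem steerWithoutPerfect_of_resolutionOfSingularities (hR : _root_.ResolutionOfSingularities) :
    SteerWithoutPerfect := by
  intro _ p hp k K _ _ _ _ O A₀ h₀ t hfg htp hfr _hreg
  have htO : t ∈ O := mem_of_pow_mem O hp.ne_zero (h₀ htp)
  have hRO := adjoin_insert_le O A₀ h₀ htO
  obtain ⟨A, h, hRA, hAfg, hreg⟩ :=
    (hR p hp).relLocalUniformization k K O _ (fg_adjoin_insert hfg t) hfr hRO
  exact ⟨A, h, (le_adjoin_insert A₀ t).trans hRA, hRA (mem_adjoin_insert A₀ t), hAfg,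
    isFractionRing_of_le hRA hfr, hreg⟩

/-- Dropping the ANTECEDENT gives exactly `TorsorLUPerfect`, again implied by the summit
(`torsorLUPerfect_of_resolutionOfSingularities`); and `TorsorLUPerfect → Steer` trivially. -/
theorem steer_of_torsorLUPerfect (h : ShadowGame.TorsorLUPerfect) : JacobianBudget.Steer :=
  fun _ => h

/-! ## §3 Degenerate instance exercised: the trivial valuation `O = K` needs no blow-up
(the model `A₀[t]` already has the four non-regularity conjuncts; regularity at the zero centre
is `case_top` of the LuAlphaPTorsor disproof file). -/

example {k K : Type} [Field k] [Field K] [Algebra k K] (A₀ : Subalgebra k K) (t : K)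
    (hfg : A₀.FG) (hfr : IsFractionRing (Algebra.adjoin k (insert t (A₀ : Set K))) K) :
    ∃ A : Subalgebra k K, A₀ ≤ A ∧ t ∈ A ∧ A.FG ∧ IsFractionRing A K :=
  ⟨_, le_adjoin_insert A₀ t, mem_adjoin_insert A₀ t, fg_adjoin_insert hfg t, hfr⟩

/-! ## §4 Load-bearing hypotheses of the CONSEQUENT — perfect-field versions, as theorems
(cdisprove cycle 1, 2026-08-17)

`ConseqWithoutH p` := the consequent of `Steer` at the prime `p` with ONE hypothesis `H` deleted,
`[PerfectField k]` KEPT, everything else verbatim. Each is FALSE by an explicit witness over the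
perfect field `𝔽_p` (so perfectness changes nothing with respect to
`Cruxes/LuAlphaPTorsor/Disproof.lean` §2, whose witnesses are re-typed here). At crux level
`SteerWithoutH := IsolatedForcedTermination → ∀ p prime, ConseqWithoutH p` is EQUIVALENT to
`¬ IsolatedForcedTermination` (`steerWithoutH_iff`): the mutation holds iff the route's own target
fails, so ANY proof of the target certifies `H` as load-bearing (`steer_false_without_H`), and no
prover of the route may drop `H`. Landed copy with inline statements (no defs):
`Theorems/Steer/Negative/ConsequentLoadBearing.lean` (proposal p156798 of this cycle). -/

section LoadBearing

open IsLocalRing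
open Summit.ResolutionOfSingularities.ResolutionOfSingularities.Theorems.PfaffLine
  (isRegularLocalRing_localizationAtPrime_of_eq_bot)

/-- The centre of the trivial valuation ring `O = K` on any model is the zero ideal. [folklore] -/
theorem centre_top_eq_bot {k K : Type} [Field k] [Field K] [Algebra k K] (A : Subalgebra k K)
    (h : A.toSubring ≤ (⊤ : ValuationSubring K).toSubring) :
    Ideal.comap (Subring.inclusion h) (maximalIdeal (⊤ : ValuationSubring K)) = ⊥ := by
  rw [maximalIdeal_eq_bot, Ideal.comap_bot_of_injective]
  exact Subring.inclusion_injective _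

/-- A proper ideal of the bottom subalgebra `k ⊆ K` (a field) is zero. [folklore] -/
theorem ideal_bot_eq_bot {k K : Type} [Field k] [Field K] [Algebra k K]
    (I : Ideal (⊥ : Subalgebra k K).toSubring) (hI : I ≠ ⊤) : I = ⊥ := by
  refine (Submodule.eq_bot_iff _).mpr fun x hx => ?_
  by_contra hx0
  apply hI
  refine Ideal.eq_top_of_isUnit_mem _ hx ?_
  have hxmem : (x : K) ∈ (⊥ : Subalgebra k K) := x.2
  rw [Algebra.mem_bot] at hxmem
  obtain ⟨c, hc⟩ := hxmem
  have hc0 : c ≠ 0 := by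
    rintro rfl
    apply hx0
    apply Subtype.ext
    simp [← hc]
  have hinv : algebraMap k K c⁻¹ ∈ (⊥ : Subalgebra k K).toSubring :=
    Subalgebra.algebraMap_mem _ _
  refine isUnit_iff_exists_inv.mpr ⟨⟨algebraMap k K c⁻¹, hinv⟩, ?_⟩
  apply Subtype.ext
  change (x : K) * algebraMap k K c⁻¹ = 1
  rw [← hc, ← map_mul, mul_inv_cancel₀ hc0, map_one]

/-- The consequent of `Steer` at `p` WITHOUT `IsFractionRing (A₀[t]) K` (`[PerfectField k]` kept). -/
def ConseqWithoutFrac (p : ℕ) : Prop :=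
  ∀ (k K : Type) [Field k] [CharP k p] [PerfectField k] [Field K] [Algebra k K]
    (O : ValuationSubring K) (A₀ : Subalgebra k K) (h₀ : A₀.toSubring ≤ O.toSubring) (t : K),
    A₀.FG → t ^ p ∈ A₀ →
    IsRegularLocalRing (Localization.AtPrime (Ideal.comap (Subring.inclusion h₀)
      (IsLocalRing.maximalIdeal O))) →
    ∃ (A : Subalgebra k K) (h : A.toSubring ≤ O.toSubring), A₀ ≤ A ∧ t ∈ A ∧ A.FG ∧
      IsFractionRing A K ∧ IsRegularLocalRing (Localization.AtPrime
        (Ideal.comap (Subring.inclusion h) (IsLocalRing.maximalIdeal O)))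

/-- **`IsFractionRing (A₀[t]) K` is load-bearing** (bookkeeping: `K/k` need not be finitely
generated): witness `k = 𝔽_p`, `K = 𝔽_p^alg`, `O = K`, `A₀ = k`, `t = 0`; a finitely generated
`A ⊆ K` with `Frac A = K` is integral, hence finite over `𝔽_p`, hence a finite field onto which the
infinite `K` cannot biject. [folklore] -/
theorem not_conseqWithoutFrac (p : ℕ) [hp : Fact p.Prime] : ¬ ConseqWithoutFrac p := by
  intro H
  let k := ZMod p
  let K := AlgebraicClosure (ZMod p)
  have h₀ : (⊥ : Subalgebra k K).toSubring ≤ (⊤ : ValuationSubring K).toSubring :=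
    fun _ _ => Subring.mem_top _
  have hreg : IsRegularLocalRing (Localization.AtPrime (Ideal.comap (Subring.inclusion h₀)
      (IsLocalRing.maximalIdeal (⊤ : ValuationSubring K)))) := by
    haveI : IsNoetherianRing (⊥ : Subalgebra k K).toSubring :=
      isNoetherianRing_of_fg Subalgebra.fg_bot
    exact isRegularLocalRing_localizationAtPrime_of_eq_bot _ (centre_top_eq_bot _ h₀)
  obtain ⟨A, h, -, -, hAfg, hAfr, -⟩ := H k K ⊤ ⊥ h₀ 0 Subalgebra.fg_bot
    (by rw [zero_pow hp.out.ne_zero]; exact zero_mem _) hreg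
  haveI : Algebra.FiniteType k A := A.fg_iff_finiteType.mp hAfg
  haveI : Algebra.IsIntegral k A := ⟨fun a =>
    (isIntegral_algHom_iff A.val Subtype.val_injective).mp (Algebra.IsIntegral.isIntegral (a : K))⟩
  haveI : Module.Finite k A := Algebra.IsIntegral.finite
  haveI : Finite A := Module.finite_of_finite k
  have hfield : IsField A := Finite.isField_of_domain A
  have hbij := hfield.localization_map_bijective (M := nonZeroDivisors A) (Rₘ := K)
    zero_notMem_nonZeroDivisors
  haveI : Finite K := Finite.of_surjective _ hbij.2
  exact not_finite K

/-- The consequent of `Steer` at `p` WITHOUT `A₀.FG` (`[PerfectField k]` kept). -/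
def ConseqWithoutFG (p : ℕ) : Prop :=
  ∀ (k K : Type) [Field k] [CharP k p] [PerfectField k] [Field K] [Algebra k K]
    (O : ValuationSubring K) (A₀ : Subalgebra k K) (h₀ : A₀.toSubring ≤ O.toSubring) (t : K),
    t ^ p ∈ A₀ → IsFractionRing (Algebra.adjoin k (insert t (A₀ : Set K))) K →
    IsRegularLocalRing (Localization.AtPrime (Ideal.comap (Subring.inclusion h₀)
      (IsLocalRing.maximalIdeal O))) →
    ∃ (A : Subalgebra k K) (h : A.toSubring ≤ O.toSubring), A₀ ≤ A ∧ t ∈ A ∧ A.FG ∧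
      IsFractionRing A K ∧ IsRegularLocalRing (Localization.AtPrime
        (Ideal.comap (Subring.inclusion h) (IsLocalRing.maximalIdeal O)))

/-- **`A₀.FG` is load-bearing**: witness `k = 𝔽_p`, `K = 𝔽_p(X)`, `A₀ = O = K`, `t = 0`; the
conclusion forces `K` to be a finitely generated `𝔽_p`-algebra, and a field finitely generated as an
algebra is finite over the base (Zariski's lemma), while `X` is transcendental. [folklore] -/
theorem not_conseqWithoutFG (p : ℕ) [hp : Fact p.Prime] : ¬ ConseqWithoutFG p := by
  intro H
  let k := ZMod p
  let K := RatFunc (ZMod p)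
  have h₀ : (⊤ : Subalgebra k K).toSubring ≤ (⊤ : ValuationSubring K).toSubring :=
    fun _ _ => Subring.mem_top _
  have hreg : IsRegularLocalRing (Localization.AtPrime (Ideal.comap (Subring.inclusion h₀)
      (IsLocalRing.maximalIdeal (⊤ : ValuationSubring K)))) := by
    haveI : IsNoetherianRing (⊤ : Subalgebra k K).toSubring :=
      isNoetherianRing_of_ringEquiv K (Subalgebra.topEquiv (R := k) (A := K)).toRingEquiv.symm
    exact isRegularLocalRing_localizationAtPrime_of_eq_bot _ (centre_top_eq_bot _ h₀)
  have hfr : IsFractionRing (Algebra.adjoin k (insert (0 : K) ((⊤ : Subalgebra k K) : Set K))) K :=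
    isFractionRing_of_le (le_adjoin_insert ⊤ 0) <|
      IsFractionRing.of_field (⊤ : Subalgebra k K) K fun z =>
        ⟨⟨z, Algebra.mem_top⟩, 1, by simp⟩
  obtain ⟨A, h, htopA, -, hAfg, -, -⟩ := H k K ⊤ ⊤ h₀ 0 (Algebra.mem_top) hfr hreg
  have hA : A = ⊤ := top_le_iff.mp htopA
  subst hA
  haveI : Algebra.FiniteType k K := ⟨hAfg⟩
  haveI : Module.Finite k K := finite_of_finite_type_of_isJacobsonRing k K
  have halg : Algebra.IsAlgebraic k K := Algebra.IsAlgebraic.of_finite k K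
  have hX : Transcendental k (RatFunc.X : K) := by
    rw [← RatFunc.algebraMap_X, transcendental_algebraMap_iff (RatFunc.algebraMap_injective k)]
    exact Polynomial.transcendental_X k
  exact hX (halg.isAlgebraic _)

/-- The consequent of `Steer` at `p` WITHOUT `t ^ p ∈ A₀` (`[PerfectField k]` kept). -/
def ConseqWithoutTorsor (p : ℕ) : Prop :=
  ∀ (k K : Type) [Field k] [CharP k p] [PerfectField k] [Field K] [Algebra k K]
    (O : ValuationSubring K) (A₀ : Subalgebra k K) (h₀ : A₀.toSubring ≤ O.toSubring) (t : K),
    A₀.FG → IsFractionRing (Algebra.adjoin k (insert t (A₀ : Set K))) K →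
    IsRegularLocalRing (Localization.AtPrime (Ideal.comap (Subring.inclusion h₀)
      (IsLocalRing.maximalIdeal O))) →
    ∃ (A : Subalgebra k K) (h : A.toSubring ≤ O.toSubring), A₀ ≤ A ∧ t ∈ A ∧ A.FG ∧
      IsFractionRing A K ∧ IsRegularLocalRing (Localization.AtPrime
        (Ideal.comap (Subring.inclusion h) (IsLocalRing.maximalIdeal O)))

/-- **`t ^ p ∈ A₀` is load-bearing, for a junk reason** (it is the only hypothesis forcing `t ∈ O`,
and the conclusion demands `t ∈ A ⊆ O`): witness `k = 𝔽_p`, `K = 𝔽_p(X)`, `A₀ = k`, `t = X`,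
`O = 𝒪_∞` (`X ∉ 𝒪_∞`). The honest mutation (arbitrary `t ∈ O`) sits between the crux and relative
LU (`Cruxes/LuAlphaPTorsor/Disproof.lean`, `WithoutTorsorMemO`): open. [folklore] -/
theorem not_conseqWithoutTorsor (p : ℕ) [hp : Fact p.Prime] : ¬ ConseqWithoutTorsor p := by
  classical
  intro H
  let k := ZMod p
  let K := RatFunc (ZMod p)
  let O : ValuationSubring K := (RatFunc.inftyValuation k).valuationSubring
  have hXO : (RatFunc.X : K) ∉ O := by
    change ¬ (RatFunc.inftyValuation k (RatFunc.X : K) ≤ 1)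
    rw [not_le, RatFunc.inftyValuation.X, ← WithZero.exp_zero, WithZero.exp_lt_exp]
    exact zero_lt_one
  have h₀ : (⊥ : Subalgebra k K).toSubring ≤ O.toSubring := by
    intro x hx
    have hx' : x ∈ (⊥ : Subalgebra k K) := hx
    rw [Algebra.mem_bot] at hx'
    obtain ⟨c, rfl⟩ := hx'
    change RatFunc.inftyValuation k (algebraMap k K c) ≤ 1
    by_cases hc : c = 0
    · simp [hc]
    · have : (algebraMap k K c) = RatFunc.C c := rfl
      rw [this, RatFunc.inftyValuation.C k hc]
  have hreg : IsRegularLocalRing (Localization.AtPrime (Ideal.comap (Subring.inclusion h₀)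
      (IsLocalRing.maximalIdeal O))) := by
    haveI : IsNoetherianRing (⊥ : Subalgebra k K).toSubring :=
      isNoetherianRing_of_fg Subalgebra.fg_bot
    exact isRegularLocalRing_localizationAtPrime_of_eq_bot _
      (ideal_bot_eq_bot _ Ideal.IsPrime.ne_top')
  have hfr : IsFractionRing (Algebra.adjoin k (insert (RatFunc.X : K)
      ((⊥ : Subalgebra k K) : Set K))) K := by
    refine IsFractionRing.of_field _ K fun z => ?_
    have hmem : ∀ q : Polynomial k, algebraMap (Polynomial k) K q ∈
        Algebra.adjoin k (insert (RatFunc.X : K) ((⊥ : Subalgebra k K) : Set K)) := by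
      intro q
      have : algebraMap (Polynomial k) K q = Polynomial.aeval (RatFunc.X : K) q := by
        rw [← RatFunc.algebraMap_X, Polynomial.aeval_algebraMap_apply,
          Polynomial.aeval_X_left_apply]
      rw [this]
      exact Algebra.adjoin_mono (Set.singleton_subset_iff.mpr (Set.mem_insert _ _))
        (Polynomial.aeval_mem_adjoin_singleton k _)
    refine ⟨⟨_, hmem z.num⟩, ⟨_, hmem z.denom⟩, ?_⟩
    exact (RatFunc.num_div_denom z).symm
  obtain ⟨A, h, -, htA, -, -, -⟩ := H k K O ⊥ h₀ RatFunc.X Subalgebra.fg_bot hfr hreg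
  exact hXO (h htA)

/-- `Steer` with `IsFractionRing (A₀[t]) K` deleted from the consequent, antecedent kept. -/
def SteerWithoutFrac : Prop :=
  FrobeniusClosing.IsolatedForcedTermination → ∀ p : ℕ, p.Prime → ConseqWithoutFrac p

/-- `Steer` with `A₀.FG` deleted from the consequent, antecedent kept. -/
def SteerWithoutFG : Prop :=
  FrobeniusClosing.IsolatedForcedTermination → ∀ p : ℕ, p.Prime → ConseqWithoutFG p

/-- `Steer` with `t ^ p ∈ A₀` deleted from the consequent, antecedent kept. -/
def SteerWithoutTorsor : Prop :=
  FrobeniusClosing.IsolatedForcedTermination → ∀ p : ℕ, p.Prime → ConseqWithoutTorsor p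

/-- **The mutation without `Frac` holds iff the route's target FAILS.** [folklore] -/
theorem steerWithoutFrac_iff :
    SteerWithoutFrac ↔ ¬ FrobeniusClosing.IsolatedForcedTermination := by
  constructor
  · intro H hT
    haveI : Fact (Nat.Prime 2) := ⟨Nat.prime_two⟩
    exact not_conseqWithoutFrac 2 (H hT 2 Nat.prime_two)
  · exact fun hn hT => absurd hT hn

/-- **The mutation without `A₀.FG` holds iff the route's target FAILS.** [folklore] -/
theorem steerWithoutFG_iff :
    SteerWithoutFG ↔ ¬ FrobeniusClosing.IsolatedForcedTermination := by
  constructor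
  · intro H hT
    haveI : Fact (Nat.Prime 2) := ⟨Nat.prime_two⟩
    exact not_conseqWithoutFG 2 (H hT 2 Nat.prime_two)
  · exact fun hn hT => absurd hT hn

/-- **The mutation without `t ^ p ∈ A₀` holds iff the route's target FAILS.** [folklore] -/
theorem steerWithoutTorsor_iff :
    SteerWithoutTorsor ↔ ¬ FrobeniusClosing.IsolatedForcedTermination := by
  constructor
  · intro H hT
    haveI : Fact (Nat.Prime 2) := ⟨Nat.prime_two⟩
    exact not_conseqWithoutTorsor 2 (H hT 2 Nat.prime_two)
  · exact fun hn hT => absurd hT hn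

/-- "Any proof of `Steer` must use `Frac (A₀[t]) = K`" — modulo the target. [folklore] -/
theorem steer_false_without_frac (hT : FrobeniusClosing.IsolatedForcedTermination) :
    ¬ SteerWithoutFrac :=
  fun H => steerWithoutFrac_iff.mp H hT

/-- "Any proof of `Steer` must use `A₀.FG`" — modulo the target. [folklore] -/
theorem steer_false_without_fg (hT : FrobeniusClosing.IsolatedForcedTermination) :
    ¬ SteerWithoutFG :=
  fun H => steerWithoutFG_iff.mp H hT

/-- "Any proof of `Steer` must use `t ^ p ∈ A₀`" — modulo the target. [folklore] -/
theorem steer_false_without_torsor (hT : FrobeniusClosing.IsolatedForcedTermination) :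
    ¬ SteerWithoutTorsor :=
  fun H => steerWithoutTorsor_iff.mp H hT

end LoadBearing

/-! ## §5 The antecedent's logical position (cdisprove cycle 1)

`¬ Steer ↔ IsolatedForcedTermination ∧ ¬ TorsorLUPerfect` (`not_steer_iff`): a refutation of the
crux must contain (i) a PROOF of the route's target and (ii) a counterexample to local
uniformization of `α_p`-torsors over a perfect field — and (ii) refutes the summit (§1,
`not_resolutionOfSingularities_of_not_steer`). Conversely `¬ IsolatedForcedTermination → Steer`
(`steer_of_not_isolatedForcedTermination`): a Hauser–Perlega forced cycle would PROVE the crux (and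
kill the route at its target instead). Status of (i), for the record: two sibling routes claim the
target is a THEOREM — WildCones' engine (`ConeExit ∧ NarrowRunsDie ∧ ClassicalRegimes →
IsolatedForcedTermination`, proved as glue; items 16882–16884 open; evidence note
`WildCones_engine_review.md` on this item: "provable outright for odd p, n ≥ 3", every isolated point
of cleaned order > p exits the isolated regime after ONE blow-up for n ≥ 3 — the transform is
divisible by the exceptional parameter `u_i`, so `J ⊆ (u_i, g)` has height ≤ 2 < n unless `g` is a
unit, in which case the cleaned order is 1) and JacobianBudget's `IsolatedJacobianDrop →
IsolatedForcedTermination` (census j022217: 1748 transitions, 0 violations). So in substance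
`Steer ≡ TorsorLUPerfect` (`steer_iff_torsorLUPerfect_of_ift`): the antecedent carries a suggested
MECHANISM (point dynamics), no logical strength. -/

section Antecedent

/-- `Steer`, unfolded (definitional). [folklore] -/
theorem steer_iff_ift_imp :
    FrobeniusClosing.Steer ↔
      (FrobeniusClosing.IsolatedForcedTermination → FrobeniusClosing.TorsorLUPerfect) :=
  Iff.rfl

/-- **What a refutation of `Steer` must contain.** [folklore] -/
theorem not_steer_iff :
    ¬ FrobeniusClosing.Steer ↔
      (FrobeniusClosing.IsolatedForcedTermination ∧ ¬ FrobeniusClosing.TorsorLUPerfect) := by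
  rw [steer_iff_ift_imp, Classical.not_imp]

/-- A counterexample to the route's target proves the crux (vacuously). [folklore] -/
theorem steer_of_not_isolatedForcedTermination
    (h : ¬ FrobeniusClosing.IsolatedForcedTermination) : FrobeniusClosing.Steer :=
  fun hT => absurd hT h

/-- Modulo the target, the crux IS torsor LU over perfect fields. [folklore] -/
theorem steer_iff_torsorLUPerfect_of_ift (hT : FrobeniusClosing.IsolatedForcedTermination) :
    FrobeniusClosing.Steer ↔ FrobeniusClosing.TorsorLUPerfect :=
  ⟨fun h => h hT, fun h _ => h⟩

/-- The two route copies of `TorsorLUPerfect` (FrobeniusClosing stmt-16158 / ShadowGame) agree.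
[folklore] -/
theorem torsorLUPerfect_iff_shadowGame :
    FrobeniusClosing.TorsorLUPerfect ↔ ShadowGame.TorsorLUPerfect := Iff.rfl

end Antecedent

/-! ## §6 TARGETS — the active line `switching-dichotomy` (skeleton sha 450bd9bb…; cdisprove cycle 1)

`Lines/switching_dichotomy.lean`: `Steer_of : stub_zeroDimPerfect → stub_switchingDefectless →
stub_switchingDefect → stub_alongPrimeTransfer → Steer` (proved); the module is not built on the
farm, so its vocabulary (`ZeroDim`, `Discrete`, `IsFracOf`, `StronglySwitching`, `Defect`, `Concl`,
`TorsorLUZeroDimBelow`) is quoted, and the formal remarks below are typed over the Literature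
declarations it is built from. Verdicts (cheap probes only; no stub is killed):

* `stub_zeroDimPerfect` (`TorsorLUZeroDim p → TorsorLU p`) — TRUE as typed, M: all four ingredients
  of the planner's proof exist in the tree (`isOpen_regularLocus_of_finiteType_field` — FieldsJ2;
  `exists_minimal_valuationSubring_le`, `exists_aeval_mem_nonunits_of_minimal`,
  `isRegularLocalRing_centre_of_le` — LocalUniformizationClosedPoints). The one trap (regular at a
  non-maximal centre ⇏ regular at a closed point above it) is exactly what the shrinking
  `A₀ ↦ A₀[g⁻¹]` handles; no misstatement.
* `stub_switchingDefectless` — consistent; not cheaply refutable. (a) `¬ Defect` EXCLUDES the true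
  birational case: if `t = y/z ∈ Frac A₀` then for every `g ∈ Frac A₀`, `t^p − g^p = (t − g)^p`
  (`K` has characteristic `p`: `charP_of_algebra`) so `w := t − g` witnesses `Defect`; hence under
  `¬ Defect`, `[K : Frac A₀] = p`, and with `f = 1` (zero-dimensional `O`, perfect `k`) the split
  `Defect / ¬ Defect` is the honest `e = 1 / e = p` dichotomy (torsion-freeness of the value group:
  `p·γ ∈ pΓ₀ ↔ γ ∈ Γ₀`). (b) The sketch's first step "the defectless witness lies in `O`" is
  `valuation_sub_pow_eq_of_not_mem` below (`g ∉ O ⇒ v(t^p − g^p) = v(g^p)`, so such `g` is no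
  witness). (c) The load-bearing import is HLOST Prop. 4.4 — NOT in the tree (`lean search` for
  Shannon/switch/HLOST: 0 declaration hits); it is where the L-size sits. (d) **VOCABULARY MISMATCH
  (read in arXiv:1505.06445: Remark 2.4 p.5, Prop. 4.4 p.9, Prop. 8.7 p.17, intro p.4).** The line's
  `StronglySwitching O A₀` says `S := ⋃ R_i = V₀ := O ∩ Frac A₀`. By Shannon 1973 / Granja 2004 as
  recorded in HLOST: `S` is a RANK-ONE valuation ring ⇔ `epd(S/R) = ∅` ⇔ the sequence "switches
  strongly infinitely often"; `S` is a RANK-TWO valuation ring ⇔ `epd(S/R) = {W}` (one essential prime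
  DIVISOR) ⇔ the sequence is "height-1 directed" (value group `ℤ ⊕ G`, `G ⊆ ℚ`); `S` is a valuation
  ring ⇔ one of the two. So the line's `StronglySwitching` = Shannon-switching (rank 1) ∪
  height-1-directed (rank 2), and its docstring's "equivalently no prime element is essential (HLOST
  4.4)" is false on the second family: HLOST 4.4 says the transform of `(a)` becomes trivial iff `a` is
  a unit of the Noetherian hull `T`, and in the height-1-directed case `T = W`, so every `a` with
  `w(a) > 0` has non-trivializing transforms. Since all `¬ Defect`-witnesses `g` share the value
  `v(t − g) = θ*` (the maximum, `∉ Γ₀`), when the `W`-component of `θ*` is positive EVERY witness has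
  `t^p − g^p` in the essential height-one prime, and the sketch's monomialization step is unsupported.
  Inhabitant of that sub-regime satisfying every hypothesis of the stub: `A₀ = k[x,y,z]`,
  `v = ord_𝔪 ∘ v̄` (or `ord_D ∘ v̄`, `D = {d = 0}` a prime divisor through `0`), `v̄` the arc valuation of
  `κ(w)` along a transcendental non-singular arc (discrete rank 1, zero-dimensional, `Σ_j v̄(𝔪_j) = ∞`,
  whence `epd = {W}`): `v` zero-dimensional, rank 2, `Γ_v = ℤ²_lex` (not Abhyankar, not `Discrete`),
  `S = V₀`; torsor `t^p = x` (resp. `d`): `θ* = v(t) = (1/p, 0)`, `¬ Defect` holds with `g* = 0`, and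
  `w(t^p) = 1 > 0`. For `w = ord_𝔪` the toroidal exit still works (`x_n` is an exceptional parameter;
  4.4 applies to `d/x^{ord d}`), so this is a gap in the cited MECHANISM, not a counterexample to the
  stub; for `w = ord_D`, `D` singular along a curve through the centres, the needed monomial form of
  `d` is an embedded point-blow-up smoothing of `D_j` at `x_j` dictated by `v̄` — plausible from
  `Σ v̄(𝔪_j) = ∞`, absent from the sketch, and really the `n − 1` instance of the TRANSFER of stub 4.
  Suggested repair (posted as `stub-misstated` evidence with signatures): add to stubs 2–3 the
  hypothesis `Arch O A₀` (the restriction of `v` to `Frac A₀` is archimedean = rank one; then the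
  line's `StronglySwitching` IS Shannon's and `T = Frac A₀`), and give `stub_alongPrimeTransfer` the
  complement `¬ (StronglySwitching ∧ Arch)`; `Steer_of` keeps its shape. Size consequence: the
  switching side only ever sees valuations of rank ≤ 2 on `Frac A₀` (rank 1 after repair); rank ≥ 3,
  generic rank 2 and Shannon's non-switching rank-1 sequences (HLOST Ex. 7.4) all sit in
  `stub_alongPrimeTransfer`, which is the bulk of the crux, not a side case.
* `stub_switchingDefect` / `stub_alongPrimeTransfer` — OPEN; both carry `hT : IsolatedForcedTermination`,
  which by §5 is in substance dischargeable (sibling routes prove the target), so neither stub should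
  expect LOGICAL mileage from `hT` — only the heuristic that the `p`-adic cleaning run is a run of
  the point dynamics. Both regimes are INHABITED in transcendence degree 3, so neither stub is
  vacuous: along-a-prime (¬ strongly switching, zero-dimensional, rank 2, not Abhyankar, not
  discrete): `A₀ = k[x,y,z]`, `v = ord_{(x,y)} ∘ v̄` with `v̄` the `z`-adic order of
  `k(z)(w) ↪ k((z))`, `w = x/y ↦ 1 + Σ z^{i!}`; values `v(z) = (0,1) < v(x) = v(y) = (1,0)`,
  `v(x − y) = (1,1)`; the quadratic sequence along `v` is `R_i = k[x/z^i, y/z^i, z]_{(·)}` for ever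
  (the exceptional parameter `z` always has the least value), and `(x − y)/y ∈ O ∩ Frac A₀` lies in
  no `R_i` (`y/z^i` is a regular parameter of `R_i` not dividing `x/z^i − y/z^i`) — Shannon's
  example read along a valuation (HLOST Discussion 4.2); residue field `k`, value group `ℤ²_lex`
  (rational rank 2 < 3 = trdeg). The strongly-switching + defect regime: degree-`p` defect
  extensions of rank-one valued function fields exist from trdeg 2 on (Kuhlmann's examples,
  Cutkosky–Piltant 2004); that they can be chosen strongly switching, non-Abhyankar, non-discrete in
  trdeg 3 is plausible but NOT certified here. NOT every zero-dimensional rank-one valuation is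
  strongly switching in dim 3: HLOST Ex. 7.4 (Shannon) — `u(x), u(y), u(z)` rationally independent
  with `u(z) > u(x) + u(y)` — gives `S ≠ V` along a RANK-ONE (Abhyankar) `u`; so `¬ StronglySwitching`
  does not force rank ≥ 2, and stub 4 must also absorb rank-one non-switching sequences (its sketch's
  "archimedean, `τ < ∞`" branch).
* No quadratic transform leaves a FIELD (`not_isQuadraticTransformAlong_of_maximalIdeal_eq_bot`):
  at the generic centre (`O = K`, §3) the sequence hypothesis of `StronglySwitching` is unsatisfiable
  at `i = 0`, so `StronglySwitching` holds vacuously and `stub_alongPrimeTransfer` is idle there —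
  consistent (`case_top` is TRUE). With `ZeroDim k O` and `trdeg ≥ 3` every `R i` has dimension
  `trdeg (Frac A₀) ≥ 3`, the sequence exists, is unique (the choice of `u₀` among least-value
  generators does not change `locAtCentre`), and the dichotomy is genuine.
-/

section Targets

open Literature.AlgebraicGeometry.Resolution (IsQuadraticTransformAlong)

variable {K : Type} [Field K]

/-- `K ⊇ k` has characteristic `p` when `k` has (used to read `Defect` as the `e = 1` case:
`t^p − g^p = (t − g)^p`). [folklore] -/
theorem charP_of_algebra (k : Type) [Field k] [Algebra k K] (p : ℕ) [CharP k p] : CharP K p :=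
  charP_of_injective_algebraMap (algebraMap k K).injective p

/-- In characteristic `p`, `t ^ p - g ^ p = (t - g) ^ p`; so for `t ∈ Frac A₀` every `g ∈ Frac A₀`
has the `Defect`-witness `w := t - g` (the birational case is on the `Defect` side). [folklore] -/
theorem sub_pow_eq_pow_sub (p : ℕ) [Fact p.Prime] [CharP K p] (t g : K) :
    t ^ p - g ^ p = (t - g) ^ p :=
  (sub_pow_char t g).symm

/-- **The defectless witness lies in `O`.** If `t ∈ O` and `g ∉ O` then `v(t^p − g^p) = v(g^p)`:
such a `g` is never a `¬ Defect`-witness (take `w := g`). First step of `stub_switchingDefectless`.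
[folklore] -/
theorem valuation_sub_pow_eq_of_not_mem (p : ℕ) [Fact p.Prime] [CharP K p]
    (O : ValuationSubring K) {t g : K} (ht : t ∈ O) (hg : g ∉ O) :
    O.valuation (t ^ p - g ^ p) = O.valuation (g ^ p) := by
  have h1 : O.valuation t ≤ 1 := (O.valuation_le_one_iff t).mpr ht
  have h2 : 1 < O.valuation g := lt_of_not_ge fun h => hg ((O.valuation_le_one_iff g).mp h)
  have hlt : O.valuation t < O.valuation g := lt_of_le_of_lt h1 h2
  rw [sub_pow_eq_pow_sub p, map_pow, map_pow, Valuation.map_sub_eq_of_lt_right _ hlt]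

/-- **No quadratic transform leaves a field**: a local subring whose maximal ideal is zero has no
quadratic transform along any `O` (the datum of `IsLocalBlowupAlong` contains a NON-ZERO generator
`u₀` of the blown-up ideal). [folklore] -/
theorem not_isQuadraticTransformAlong_of_maximalIdeal_eq_bot (O : ValuationSubring K)
    (R R₁ : Subring K) [IsLocalRing R] (hR : IsLocalRing.maximalIdeal R = ⊥) :
    ¬ IsQuadraticTransformAlong O R R₁ := by
  rintro ⟨_, -, u, u₀, hu, hu₀, h0, -, -⟩
  apply h0
  have hmem : u₀ ∈ IsLocalRing.maximalIdeal R :=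
    hu ▸ Ideal.subset_span (Finset.mem_coe.mpr hu₀)
  rw [hR] at hmem
  exact (Submodule.mem_bot _).mp hmem

end Targets

end Summit.ResolutionOfSingularities.ResolutionOfSingularities.Cruxes.Steer.Disproof
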